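import Literature.MathematicalPhysics.QuantumFieldTheory.Balaban1983to89.B14Eq213DetSet
import Literature.MathematicalPhysics.QuantumFieldTheory.BalabanImbrieJaffe1984to88.BIJ85Eq453GaugeField

/-!
# `Balaban1983to89.B15Eq133JoinDeterminingSet` — T. Bałaban, *Large field renormalization. I. The basic step of the 𝐑 operation*,
# Commun. Math. Phys. **122** (1989) 175–202 [Balaban1989LargeFieldI] = «[IV]», display (1.33) p. 184: the configuration
# `V^{(j)}_{Z_{j+1}∖Z_j}` WITH ITS DISPLAYED BODY — the two-domain (2.14)-join `𝔹(Z_{j+1}∖Z_j) ∪ 𝔹_k` of [III] at print's instance —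
# and print's sentence *"In fact in the above case it is simply given by 𝔹_{j+1}(Z_{j+1})↾_{Ω_{j+1}} ∪ 𝔹_j(Z^c_j)↾_{Ω^c_{j+1}}"*
# PROVED as an identity of determining sets, from a LOCALITY theorem for the maximal sequence of [III] (2.13)

statement-level skeleton of published theorems with citation tags; proofs where landed; nothing here is a claim about
the Yang–Mills mass gap

PDF held: `paper:balaban1989-cmp122-large-field-i` (journal page = PDF page + 174); p. 184 [PDF 10] READ AS AN IMAGE on the x2
render `run/shared/lean/pub/pub-balaban/b2b-balaban-ref1/pages/1989-cmp122-large-field-I/1989-cmp122-large-field-I-p010-x2.png`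
(also p. 178 `…-p004-x2.png`, p. 183 `…-p009-x2.png`).  [III] = T. Bałaban, *Convergent renormalization expansions for lattice gauge
theories*, Commun. Math. Phys. **119** (1988) 243–285 [Balaban1988Convergent], held `paper:balaban1988-cmp119-convergent-renormalization`
(journal page = PDF page + 242); pp. 254–257 [PDF 12–15] and p. 269 [PDF 27] read on the x2 renders
`…/1988-cmp119-convergent-renormalization/1988-cmp119-convergent-renormalization-p012…p015-x2.png`, `…-p027-x2.png`.

CITATION HEADER / WHAT IS REPRODUCED (mega-formalization `lit-balaban`, HOME `run/shared/lean/pub/lit-balaban/`; unit `lit-balaban-p29`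
gen 42, Phase-2 free target under ruling G.5-34 (d); TAKING line HOME/STATUS.md 2026-08-25T03:30Z).  SKELETON row **B15.Eq1.33** (owner
r12, gated; PROXY constituent r11 under G.5-61).  The lead's head word Q-B15-r11-1 (RULING G.5-61 (4), HOME/STATUS 2026-08-24T19:44:23Z)
names the two things this file supplies: *"(a) the DISPLAYED (2.14)-join body «U(𝔹(Z_{j+1}∖Z_j) ∪ 𝔹_k, M˙(Q^{s*}V))» typed at print's
instance … and (b) print's «in fact … it is simply given by 𝔹_{j+1}(Z_{j+1})↾ ∪ 𝔹_j(Z_jᶜ)↾» identification as a KERNEL THEOREM"*.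
r12's `B15DeterminingSets.vSeam133` (p243299) types (1.33) by the simplified form; nothing of r12's or r11's files is edited or
restated — `B15DeterminingSets.{genSet, gammaRegion, pts, DetSet.restrict, join214, vSeam133, spliceAt, avgFamily}` (r12),
`B14.Eq213DetSet.{maxDomT, Bj, innerTwoT, joinBj, mem_maxDomT_iff, …}` and `B14.Eq213MaximalDomains.{maxDom, cubeExt, reach, …}` (r11),
`BIJ85Eq453GaugeField.qsstarGIter0` (p31) are USED BY NAME.

THE PRINTED TEXT.  [IV] p. 184 [PDF 10], verbatim: *"The configuration V^{(j)}_{Z_{j+1}∖Z_j} is defined on Z^{∼−1}_{j+1}∖Z^∼_j by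
V^{(j)}_{Z_{j+1}∖Z_j} = M^j(U(𝔹(Z_{j+1}∖Z_j) ∪ 𝔹_k, M˙(Q^{s*}V))), (1.33) where the determining set was defined in (2.14) [III]. In fact
in the above case it is simply given by 𝔹_{j+1}(Z_{j+1})↾_{Ω_{j+1}} ∪ 𝔹_j(Z^c_j)↾_{Ω^c_{j+1}}, and the configuration Q^{s*}V is equal
to Q^{s*}_{j+1}V_{j+1} on Ω_{j+1}∩Z_{j+1}, and to Q^{s*}_jV_j on Ω^c_{j+1}∩Z^c_j."*  [III] p. 256–257 [PDF 14–15]: *"Consider a domain Ω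
such that it is a union of M₁-cubes in the lattice T_ξ, ξ = L^{−j}. For this domain we build a minimal determining set with a support
in Ω, or a sequence of maximal domains Ω = Ω₀ ⊃ Ω₁ ⊃ .... ⊃ Ω_j … We denote this determining set by 𝐁_j(Ω) … If we are given a
determining set 𝐁, and the corresponding function U_𝐁, then it is frequently necessary to localize them to a domain Ω. Assume that
∂Ω ⊂ Ω_j∖Ω_{j+1} … Take the set 𝐁_j(Ω), and form a new determining set by 𝐁∪𝐁_j(Ω) = (𝐁∩Ω^{∼−2})∪(𝐁_j(Ω)∩(Ω∖Ω^{∼−2})). (2.14) …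
We can also have a more complicated situation, in which the boundary ∂Ω is contained in several different domains Ω_j∖Ω_{j+1}. Then
we construct the corresponding determining sets restricted to the domains, and we define the set 𝐁∪𝐁(Ω) by (2.14), with the right-hand
side summed up over the domains."*  [III] p. 269 [PDF 27] (the same sentence in [III]'s own step): *"We take the determining set
𝐁(Λᶜ_{k+1}∩Λ_k)∪𝐁_{k+1} defined in (2.14), which in this case is simply equal to the union 𝐁_{k+1}(Λᶜ_{k+1})|_{Ω_{k+1}} ∪ 𝐁_k(Λ_k)|_{Ωᶜ_{k+1}},
and the corresponding function U_{k+1,Λᶜ_{k+1}∩Λ_k}(V) = U(𝐁(Λᶜ_{k+1}∩Λ_k)∪𝐁_{k+1}, (M˙(Q^{s*}_{k+1}V_{k+1})|_{Λᶜ_{k+1}∩Ω_{k+1}},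
M˙(Q^{s*}_kV_k)|_{Λ_k∩Ωᶜ_{k+1}}))."* (with [III] (2.3) `Z_j = Λᶜ_j` this is [IV]'s sentence at `j = k`).

READING (declared; the cell's standing readings, nothing new).  (a) CARRIERS as in `B15DeterminingSets` / `B14.Eq213DetSet`: the
finest lattice `T_η` of step `k` is `Site P 0` (= the `T_ξ` of every earlier step as a site set), `T^{(n)} = Site P n`, regions are
subsets of `Site P 0`, `X^{(n)} = pts n X`; a determining set is r12's `DetSet`; the "M₁-cubes of T_ξ" and the "LⁿξM₁-cubes" of [III]
p. 256 are r11's cubes of `side L M₁ n = LⁿM₁` sites read on p29's universal cover `cover : ℤᵈ → T_η`; `𝐁_m(Ω) = Bj M₁ Ω m`,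
`Ω^{∼−2} = innerTwoT M₁ Ω m` (two layers of `s_m`-cubes, *"the operation ∼ is taken for M₁-cubes"*), the (2.14) join = `joinBj`.
(b) THE TWO-DOMAIN JOIN of p. 257 (*"summed up over the domains"*) for `Ω = Z_{j+1}∖Z_j`, whose boundary has the part `∂Z_{j+1}` in
the domain `Ω_{j+1}` (scale `j + 1`) and the part `∂Z_j` in `Ω_j∖Ω_{j+1}` (scale `j`): the scale-`(j+1)` join `joinBj M₁ 𝔹_k Ω (j+1)`
restricted to `Ω_{j+1}` together with the scale-`j` join `joinBj M₁ 𝔹_k Ω j` restricted to `Ωᶜ_{j+1}` — each domain with its own `𝐁_m(Ω)`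
AND its own `Ω^{∼−2}` (`join133`); `𝔹_k = genSet Ωs k` is the determining set (2.2) of the density's sequence `{Ω_n}_{n ≤ k}` (as in
`B15DeterminingSets.detSetN`).  (c) *"𝔹_{j+1}(Z_{j+1})"*, *"𝔹_j(Zᶜ_j)"* = the (2.13) sets *"with a support in"* their domains: r11's `Bj`
carries the (2.2)-literal scale-`0` member `Γ₀ = (Ω₁)ᶜ` taken in the WHOLE torus (`Bj_zero`; at positive scales `Bj` lives over its
domain, `Bj_subset_pts`), so the support clause is the restriction to the domain: `bUp133 = (Bj M₁ Z_{j+1} (j+1)).restrict Z_{j+1}`,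
`bLow133 = (Bj M₁ Zᶜ_j j).restrict Zᶜ_j`.  §6 PROVES that this is the reading under which print's sentence holds and that the
unrestricted one makes it false at scale `0` (`join133_ne_unrestricted`; see HONEST SCOPE (ii)).  (d) The [III] (2.12) solution map
`U(𝐁, ·)` is DATA (`DetBackground`, [15] Thm 1 = rows B14.Eq2.12 / B11.Thm1, NOT asserted); `M˙ = avgFamily`, `M^j = Averaging.iter`;
`Q^{s*}_m = qsstarGIter0 m` ([III] (1.3) with `m`-blocks, p31).  (e) The last sentence of (1.33) pins `Q^{s*}V` on the bonds inside
`Ω_{j+1}∩Z_{j+1}` and inside `Ωᶜ_{j+1}∩Zᶜ_j` and nothing else: typed as the located PROPERTY `IsQsV133`, with r11's spliced instance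
(the argument of `B15Eq13Concrete.vSeam18`) as the witness `qsV133`.

WHAT THIS FILE PROVES (kernel-checked, zero `sorry`, axioms `propext`/`Classical.choice`/`Quot.sound`; definitions WITH BODIES
`join133`, `bUp133`, `bLow133`, `vSeam133join`, `IsQsV133`, `qsV133` and the hypothesis bundle `Geometry133`; no named `Prop` fact).
§1 LOCALITY of r11's maximal sequence `maxDom` on the cover: membership of `x` in `Ω_n` depends on `Ω` only through the `w_n`-collar
   (`w_n = reach = s_1 + … + s_n ≤ 2s_n`) of the `s_n`-cube of `x` (`maxDom_local`, by the arithmetic of r11's `cube_subset_maxDom_of_ext`).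
§2 Torus descent (`maxDomT_local`, radius `3s_m`), `innerTwoT_mono`.
§3 Scale bookkeeping for the (2.2) members `Γ_n` (`mem_gammaRegion_iff_eq`, `mem_gammaRegion_congr`).
§4 The generic half `join_half_iff`: on a region `D` with `D ∩ Y ⊆ Ω ⊆ Y`, locality on `D ∩ Ω` and "only `Γ_m` through `D ∩ Ω^{∼−2}`",
   the (2.14) join of `𝔹_k` with `𝐁_m(Ω)` coincides pointwise with `𝐁_m(Y)` supported in `Y`.
§5 The objects: `join133` (the displayed determining set of (1.33)), `bUp133`/`bLow133`, `join133_subset` (the join lives on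
   `Z_{j+1}∖Z_j` at EVERY scale), `bUp133_apply_of_pos`/`bUp133_zero`.
§6 `Geometry133` = the located geometry of *"the above case"*; **`Geometry133.join133_eq`: `𝔹(Z_{j+1}∖Z_j) ∪ 𝔹_k =
   𝔹_{j+1}(Z_{j+1})↾_{Ω_{j+1}} ∪ 𝔹_j(Zᶜ_j)↾_{Ωᶜ_{j+1}}`** (halves `halfA`/`halfB` = §4 at `(Y, m, D) = (Z_{j+1}, j+1, Ω_{j+1})` and
   `(Λ_j, j, Ωᶜ_{j+1})`); `join133_apply_of_pos` (at positive scales also with the unrestricted `Bj`), `join133_ne_unrestricted`.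
§7 `vSeam133join` = (1.33) with the displayed body; **`vSeam133join_eq_vSeam133`**: it IS r12's `vSeam133 bg (bUp133 …) (bLow133 …)
   (Ω_{j+1}) QsV j`; `IsQsV133` + `isQsV133_qsV133`; `vSeam133join_qsV133`.
§8 The two separation clauses of `Geometry133` DERIVED from [III] (3.5) (`Ω_{j+1} ⊆ (Z̃⁸_j)ᶜ`) and (3.20)
   (`Λ_{j+1} = ((Ωᶜ_{j+1})^{∼2} ∪ R′^∼)ᶜ`) in their typed cover forms (`B14DomainGeom.omega35_subset_compl_enl`,
   `lambda320_far_from_compl`), given the comparisons `3s_{j+1} ≤ 8s′`, `3s_j ≤ 2s′` with the `LMR_{j+1}`-cube side `s′`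
   (`far1_of_eq35`, `far0_of_eq320`).

HYPOTHESES, all located in `Geometry133`'s docstring: `1 ≤ M₁`, `s_{j+1} ∣ 2L^{m+K}` (r11's standing divisibility), `1 ≤ j`, `j + 1 ≤ k`
((1.2)), `{Ω_n}` nested and `Ω_{j+2} ⊂ Λ_{j+1} ⊂ Ω_{j+1} ⊂ Λ_j ⊂ Ω_j` ([III] (2.1)), and the two separations of *"the above case"* (p. 177
conditions (i)–(ii): no 𝐑-operation inside the component, so [III] (3.5)/(3.20) apply): `Ω_{j+1}` is `3s_{j+1}`-far from `Z_j` and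
`Ωᶜ_{j+1}` is `3s_j`-far from `Λ_{j+1}` on the cover (print: boundaries `≥ 2MR_j` resp. two layers of `LMR_{j+1}`-cubes apart; the
comparison `3L^{j+1}M₁ ≤ 2L^jMR_j` etc. of print's constants is the consumer's, as in r11's `dist_maxDomT`).  A scratch instance on a
genuine `Setup.Params` (`d = 1`, `L = 3`, 162 sites; `j = 1`, `k = 2`, `Z_j = ∅`, `Z_{j+1} = T`) inhabits `Geometry133` (kept in the
seat folder, not shipped).

HONEST SCOPE.  (i) Set-level and definitional: the analytic content behind (1.33) — existence/uniqueness of the minimal orbit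
`U(𝐁, ·)` ([15] Thm 1) and the representation (1.34)–(1.37) — is untouched (rows B14.Eq2.12, B15.Eq1.34-1.36); the identity of §6 is
pure cube geometry + (2.2) bookkeeping, exactly what *"it is simply given by"* asserts.  (ii) READING POINT, located: with r11's
unrestricted `Bj` (scale-`0` member global) the right-hand side of the «in fact» sentence would carry `Λ_{j+1}` (from
`𝔹_{j+1}(Z_{j+1})↾_{Ω_{j+1}}`) and `Z_j` (from `𝔹_j(Zᶜ_j)↾_{Ωᶜ_{j+1}}`) at scale `0`, both OUTSIDE `Z_{j+1}∖Z_j`, while the (2.14) join —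
and [III] p. 269's data `M˙(Q^{s*}_{k+1}V_{k+1})|_{Λᶜ_{k+1}∩Ω_{k+1}}, M˙(Q^{s*}_kV_k)|_{Λ_k∩Ωᶜ_{k+1}}`, given exactly on the two supports —
live on `Z_{j+1}∖Z_j`; `join133_ne_unrestricted` records that the unrestricted reading falsifies the printed sentence whenever
`Λ_{j+1} ∪ Z_j ≠ ∅`, and `join133_apply_of_pos` that the two readings agree at every positive scale.  r11's (1.8) instance
`B15Eq13Concrete.vSeam18` (p386016) feeds r12's `vSeam133` the unrestricted pair; whether it takes the support clause is r11's call
(INBOX note 2026-08-25) — nothing of that file is touched here.  (iii) Interface bonds of `Q^{s*}V` (one endpoint in each region) are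
not pinned by print; `IsQsV133` leaves them free, `qsV133` sends them to the `Ω_{j+1}` side (r11's choice).  (iv) Head of row
B15.Eq1.33 = the PROXY's / lead's word (class C); this file only supplies the member.

## References
* [Balaban1989LargeFieldI] T. Bałaban, Commun. Math. Phys. 122 (1989) 175–202, (1.33) p. 184; (1.2)–(1.9) p. 178; p. 177.
* [Balaban1988Convergent] T. Bałaban, Commun. Math. Phys. 119 (1988) 243–285, (2.1)–(2.3) pp. 254–255, (2.13)–(2.16) pp. 256–257,
  (3.20)–(3.22) p. 269.
* [Balaban1987RG1] T. Bałaban, Commun. Math. Phys. 109 (1987) 249–301, (0.1) p. 251 (lattices, cubes `X̃ⁿ`).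
-/

namespace Literature.MathematicalPhysics.QuantumFieldTheory.Balaban1983to89.B15Eq133JoinDeterminingSet

open Literature.MathematicalPhysics.QuantumFieldTheory.Balaban1983to89
open B14DomainGeom B14.Eq213MaximalDomains B15Eq112TorusCover B15DeterminingSets B14.Eq213DetSet
open Literature.MathematicalPhysics.QuantumFieldTheory.BalabanImbrieJaffe1984to88.BIJ85Eq453GaugeField

/-! ## §1  LOCALITY of the maximal sequence of [III] (2.13) on the universal cover `ℤᵈ` -/

section CoverLocality

variable {d : ℕ}

/-- A point lies in its own cube: `s·a_i ≤ x_i ≤ s·a_i + s − 1` for `a = cubeIdx s x`. [folklore] -/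
private theorem cube_bounds (s : ℕ) (hs : 0 < s) (x : Pt d) (i : Fin d) :
    (s : ℤ) * cubeIdx s x i ≤ x i ∧ x i ≤ (s : ℤ) * cubeIdx s x i + s - 1 :=
  ⟨cubeIdx_le s hs x i, by have := lt_cubeIdx s hs x i; omega⟩

/-- Lower index bound from a lower coordinate bound: `s·c ≤ z_i ⇒ c ≤ cubeIdx s z i`. [folklore] -/
private theorem le_cubeIdx_of_le (s : ℕ) (hs : 0 < s) (z : Pt d) (i : Fin d) (c : ℤ) (h : (s : ℤ) * c ≤ z i) :
    c ≤ cubeIdx s z i := by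
  unfold cubeIdx
  exact (Int.le_ediv_iff_mul_le (by exact_mod_cast hs)).2 (by rw [mul_comm]; exact h)

/-- Upper index bound from a strict upper coordinate bound: `z_i < s·c ⇒ cubeIdx s z i < c`. [folklore] -/
private theorem cubeIdx_lt_of_lt (s : ℕ) (hs : 0 < s) (z : Pt d) (i : Fin d) (c : ℤ) (h : z i < (s : ℤ) * c) :
    cubeIdx s z i < c := by
  unfold cubeIdx
  exact (Int.ediv_lt_iff_lt_mul (by exact_mod_cast hs)).2 (by rw [mul_comm]; exact h)

/-- A point of the cube lies in every nonnegative collar of it. [folklore] -/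
private theorem mem_cubeExt_of_cubeIdx (s : ℕ) (hs : 0 < s) {x : Pt d} {a : Pt d} (hx : cubeIdx s x = a) {w : ℤ}
    (hw : 0 ≤ w) : x ∈ cubeExt s a w := by
  intro i
  have hb := cube_bounds s hs x i
  rw [hx] at hb
  exact ⟨by linarith [hb.1], by linarith [hb.2]⟩

/-- **Locality of the maximal sequence, one-sided form.**  If every point of the `w_n`-collar (`w_n = reach`, `s_1 + … + s_n`)
of the `s_n`-cube of index `a` that lies in `Y` also lies in `Y′`, then every point of that cube lying in `Y_n` lies in `Y′_n`:
the constraints defining `Ω_n` on p. 256 (*"Ω_n is a union of LⁿξM₁-cubes, and dist(Ω_n, Ωᶜ_{n−1}) ≧ LⁿξM₁"*, taken maximally)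
only test the domain inside that collar (induction on `n`, the arithmetic of r11's `cube_subset_maxDom_of_ext`).
[cite: Balaban1988Convergent, (2.13) pp.256–257] -/
theorem maxDom_local_imp {L M₁ : ℕ} (hL : 1 ≤ L) (hM : 1 ≤ M₁) {Y Y' : Set (Pt d)} :
    ∀ (n : ℕ) (a : Pt d), (∀ z ∈ cubeExt (side L M₁ n) a (reach L M₁ n), z ∈ Y → z ∈ Y') →
      ∀ x : Pt d, cubeIdx (side L M₁ n) x = a → x ∈ maxDom L M₁ Y n → x ∈ maxDom L M₁ Y' n := by
  intro n
  induction n with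
  | zero =>
    intro a hext x hx hxY
    exact hext x (mem_cubeExt_of_cubeIdx _ (side_pos hL hM 0) hx (by simp [reach])) hxY
  | succ n ih =>
    intro a hext x hx hxY x' hx' y hy
    have hs : 0 < side L M₁ n := side_pos hL hM n
    have hS : 0 < side L M₁ (n+1) := side_pos hL hM (n+1)
    have hSL : (side L M₁ (n+1) : ℤ) = (side L M₁ n : ℤ) * L := by rw [side_succ]; push_cast; ring
    have hyY : y ∈ maxDom L M₁ Y n := hxY x' hx' y hy
    refine ih (cubeIdx (side L M₁ n) y) ?_ y rfl hyY
    intro z hz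
    apply hext
    intro i
    have hxa : cubeIdx (side L M₁ (n+1)) x' = a := by rw [hx', hx]
    have hb := cube_bounds (side L M₁ (n+1)) hS x' i
    rw [hxa] at hb
    have hyi : |x' i - y i| ≤ (side L M₁ (n+1) : ℤ) - 1 := hy i
    have hy1 : (side L M₁ (n+1) : ℤ) * a i - side L M₁ (n+1) + 1 ≤ y i := by
      have := (abs_le.1 hyi).2; linarith [hb.1]
    have hy2 : y i ≤ (side L M₁ (n+1) : ℤ) * a i + 2 * side L M₁ (n+1) - 2 := by
      have := (abs_le.1 hyi).1; linarith [hb.2]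
    have hup : cubeIdx (side L M₁ n) y i + 1 ≤ (L : ℤ) * (a i + 2) := by
      have : cubeIdx (side L M₁ n) y i < (L : ℤ) * (a i + 2) :=
        cubeIdx_lt_of_lt (side L M₁ n) hs y i _ (by rw [← mul_assoc, ← hSL]; linarith)
      omega
    have hlo : (L : ℤ) * (a i - 1) ≤ cubeIdx (side L M₁ n) y i :=
      le_cubeIdx_of_le (side L M₁ n) hs y i _ (by rw [← mul_assoc, ← hSL]; linarith)
    have hz' := hz i
    have hreach : (reach L M₁ (n+1) : ℤ) = side L M₁ (n+1) + reach L M₁ n := by simp [reach]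
    have hsn : (0 : ℤ) ≤ side L M₁ n := by exact_mod_cast hs.le
    constructor
    · have h1 : (side L M₁ (n+1) : ℤ) * (a i - 1) ≤ (side L M₁ n : ℤ) * cubeIdx (side L M₁ n) y i := by
        rw [hSL, mul_assoc]; exact mul_le_mul_of_nonneg_left hlo hsn
      linarith [hz'.1]
    · have h2 : (side L M₁ n : ℤ) * (cubeIdx (side L M₁ n) y i + 1) ≤ (side L M₁ (n+1) : ℤ) * (a i + 2) := by
        rw [hSL, mul_assoc]; exact mul_le_mul_of_nonneg_left hup hsn
      linarith [hz'.2]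

/-- **Locality of the maximal sequence.**  If `Y` and `Y′` agree on the `w_n`-collar of the `s_n`-cube of `x`, then
`x ∈ Y_n ↔ x ∈ Y′_n` — the maximal sequence of p. 256 is a LOCAL function of the domain.
[cite: Balaban1988Convergent, (2.13) pp.256–257] -/
theorem maxDom_local {L M₁ : ℕ} (hL : 1 ≤ L) (hM : 1 ≤ M₁) {Y Y' : Set (Pt d)} (n : ℕ) (x : Pt d)
    (h : ∀ z ∈ cubeExt (side L M₁ n) (cubeIdx (side L M₁ n) x) (reach L M₁ n), z ∈ Y ↔ z ∈ Y') :
    x ∈ maxDom L M₁ Y n ↔ x ∈ maxDom L M₁ Y' n :=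
  ⟨maxDom_local_imp hL hM n _ (fun z hz => (h z hz).1) x rfl,
    maxDom_local_imp hL hM n _ (fun z hz => (h z hz).2) x rfl⟩

/-- The `w`-collar of the `s`-cube of `x` lies in the sup-ball of radius `s − 1 + w` about `x`. [folklore] -/
private theorem within_of_mem_cubeExt {s : ℕ} (hs : 0 < s) {x z : Pt d} {w : ℤ}
    (hz : z ∈ cubeExt s (cubeIdx s x) w) : Within ((s : ℤ) - 1 + w) x z := by
  intro i
  have hb := cube_bounds s hs x i
  have hz' := hz i
  rw [abs_le]
  constructor <;> linarith [hb.1, hb.2, hz'.1, hz'.2]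

/-- The locality radius: `s_n − 1 + w_n ≤ 3 s_m` for `n ≤ m` (`w_n ≤ 2 s_n` for `L ≥ 2`, `reach_le`). [folklore] -/
private theorem radius_le {L M₁ : ℕ} (hL : 2 ≤ L) (hM : 1 ≤ M₁) {n m : ℕ} (hnm : n ≤ m) :
    (side L M₁ n : ℤ) - 1 + reach L M₁ n ≤ 3 * side L M₁ m := by
  have h1 : reach L M₁ n ≤ 2 * side L M₁ n := reach_le hL M₁ n
  have h2 : side L M₁ n ≤ side L M₁ m := by
    unfold side
    exact Nat.mul_le_mul_right _ (Nat.pow_le_pow_right (by omega) hnm)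
  have h1' : (reach L M₁ n : ℤ) ≤ 2 * side L M₁ n := by exact_mod_cast h1
  have h2' : (side L M₁ n : ℤ) ≤ side L M₁ m := by exact_mod_cast h2
  have _ := hM
  linarith

end CoverLocality

/-! ## §2  Locality on the torus `T_η = Site P 0` (descent through the universal cover) -/

section TorusLocality

variable {P : Params} {M₁ : ℕ}

/-- `2 ≤ L` for the `Setup` parameters (`L` odd, `L > 1`). [folklore] -/
private theorem two_le_L (P : Params) : 2 ≤ P.L := P.hL.2

/-- **Locality of the torus maximal sequence `Ω_n = maxDomT`.**  If two torus domains `Y, Y′` have pull-backs agreeing on the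
sup-ball of radius `3 s_m` (`s_m = LᵐM₁` sites of `T_η`) about the standard lift of `a`, then `a ∈ Y_n ↔ a ∈ Y′_n` for every
`n ≤ m` (standing divisibility `s_m ∣ 2L^{m+K}` for the descent `mem_maxDomT_iff`).
[cite: Balaban1988Convergent, (2.13) pp.256–257] -/
theorem maxDomT_local (hM : 1 ≤ M₁) {Y Y' : Set (Site P 0)} {m : ℕ} (hdiv : side P.L M₁ m ∣ P.sitesPerDir 0)
    {a : Site P 0}
    (h : ∀ z : Pt P.d, Within (3 * side P.L M₁ m : ℤ) (lift P a) z → (cover P z ∈ Y ↔ cover P z ∈ Y'))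
    {n : ℕ} (hn : n ≤ m) : a ∈ maxDomT M₁ Y n ↔ a ∈ maxDomT M₁ Y' n := by
  rw [mem_maxDomT_iff hM hdiv hn, mem_maxDomT_iff hM hdiv hn]
  refine maxDom_local (le_trans (by norm_num) (two_le_L P)) hM n (lift P a) fun z hz => ?_
  have hs : 0 < side P.L M₁ n := side_pos P.L_pos hM n
  have hw : Within (3 * side P.L M₁ m : ℤ) (lift P a) z :=
    Within.mono (radius_le (two_le_L P) hM hn) (within_of_mem_cubeExt hs hz)
  exact h z hw

/-- `s_j ∣ s_{j+1}` (nested partitions), so the standing divisibility descends from scale `j + 1` to scale `j`. [folklore] -/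
private theorem side_dvd_side_succ (L M₁' j : ℕ) : side L M₁' j ∣ side L M₁' (j + 1) :=
  ⟨L, by rw [side_succ]; ring⟩

/-- `Ω^{∼−2}` is monotone in the domain. [cite: Balaban1988Convergent, (2.13)–(2.14) pp.256–257] -/
theorem innerTwoT_mono {Ω Ω' : Set (Site P 0)} (h : Ω ⊆ Ω') (m : ℕ) : innerTwoT M₁ Ω m ⊆ innerTwoT M₁ Ω' m := by
  unfold innerTwoT
  exact Set.image_mono (innerN_mono _ _ (Set.preimage_mono h))

end TorusLocality


/-! ## §3  Scale bookkeeping for the members `Γ_n` of a determining set ([III] (2.2)) -/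

section Scales

variable {P : Params}

/-- For a NESTED sequence `A` and a point `x ∈ A_m` with `x ∉ A_{m+1}` whenever `m < k` (`1 ≤ m ≤ k`), the only member of the
(2.2) determining set `{Γ_n}` of `A` (top scale `k`) containing `x` is `Γ_m` — the scale bookkeeping behind *"V = V_j on Γ_j"*.
[cite: Balaban1988Convergent, (2.2) p.255] -/
theorem mem_gammaRegion_iff_eq (A : ℕ → Set (Site P 0)) (hA : Antitone A) {m k : ℕ} (hmk : m ≤ k) (hm : 1 ≤ m)
    {x : Site P 0} (hx : x ∈ A m) (hx' : m < k → x ∉ A (m + 1)) (n : ℕ) :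
    x ∈ gammaRegion A k n ↔ n = m := by
  by_cases hkn : k < n
  · rw [gammaRegion_of_gt A hkn]
    exact ⟨fun h => absurd h (Set.notMem_empty x), fun h => by omega⟩
  by_cases hnk : n = k
  · subst hnk
    rw [gammaRegion_self]
    refine ⟨fun h => ?_, fun h => by rw [h]; exact hx⟩
    by_contra hne
    have hlt : m < n := lt_of_le_of_ne hmk (Ne.symm hne)
    exact hx' hlt (hA (Nat.succ_le_of_lt hlt) h)
  by_cases hn0 : n = 0
  · subst hn0
    rw [gammaRegion_zero A (by omega)]
    refine ⟨fun h => absurd (hA hm hx) h, fun h => by omega⟩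
  rw [gammaRegion_mid A (by omega) (by omega)]
  refine ⟨fun h => ?_, fun h => ?_⟩
  · rcases lt_trichotomy n m with hlt | rfl | hgt
    · exact absurd (hA (Nat.succ_le_of_lt hlt) hx) h.2
    · rfl
    · exact absurd (hA (Nat.succ_le_of_lt hgt) h.1) (hx' (by omega))
  · subst h
    exact ⟨hx, hx' (by omega)⟩

/-- Two sequences agreeing AT `x` up to scale `m` (`1 ≤ m`) have the same (2.2) members at `x` (top scale `m`).
[cite: Balaban1988Convergent, (2.2) p.255] -/
theorem mem_gammaRegion_congr (A B : ℕ → Set (Site P 0)) {m : ℕ} (hm : 1 ≤ m) {x : Site P 0}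
    (h : ∀ i, i ≤ m → (x ∈ A i ↔ x ∈ B i)) (n : ℕ) : x ∈ gammaRegion A m n ↔ x ∈ gammaRegion B m n := by
  by_cases hmn : m < n
  · rw [gammaRegion_of_gt A hmn, gammaRegion_of_gt B hmn]
  by_cases hnm : n = m
  · subst hnm
    rw [gammaRegion_self, gammaRegion_self]
    exact h n le_rfl
  by_cases hn0 : n = 0
  · subst hn0
    rw [gammaRegion_zero A (by omega), gammaRegion_zero B (by omega), Set.mem_compl_iff, Set.mem_compl_iff, h 1 hm]
  rw [gammaRegion_mid A (by omega) (by omega), gammaRegion_mid B (by omega) (by omega), Set.mem_sdiff, Set.mem_sdiff,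
    h n (by omega), h (n + 1) (by omega)]

end Scales

/-! ## §4  The generic half: on a domain `D`, the (2.14) join of `𝔹_k` with `𝐁_m(Ω)` IS `𝐁_m(Y)` supported in `Y` -/

section Generic

variable {P : Params} {M₁ : ℕ}

/-- **The two halves of the «in fact» sentence have one shape.**  Data: the density's sequence `{Ω_n}` (`Ωs`, top scale `k`), a
scale `m ≥ 1`, the domain of the join `Ω ⊆ Y`, and a region `D` with `D ∩ Y ⊆ Ω`.  If on `D ∩ Ω^{∼−2}` the only member of `𝔹_k`
through a point is `Γ_m` (`hk`), and on `D ∩ Ω` the maximal sequences of `Ω` and of `Y` agree up to scale `m` (`hloc`, locality),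
then at every point of `D` and every scale `n`: *[`x ∈ (𝔹_k)_n ∩ Ω^{∼−2}` or `x ∈ 𝐁_m(Ω)_n ∩ (Ω∖Ω^{∼−2})`]  iff
[`x ∈ 𝐁_m(Y)_n` and `x ∈ Y`]* — (2.14) against *"𝐁_m(Y) with a support in Y"* ([III] p. 256) on `D`.
[cite: Balaban1988Convergent, (2.14) p.257; Balaban1989LargeFieldI, (1.33) p.184] -/
theorem join_half_iff (hM : 1 ≤ M₁) {Ωs : ℕ → Set (Site P 0)} {k m : ℕ} (hm : 1 ≤ m) {Y Ω D : Set (Site P 0)}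
    (hΩY : Ω ⊆ Y) (hDY : D ∩ Y ⊆ Ω)
    (hk : ∀ x ∈ D ∩ innerTwoT M₁ Ω m, ∀ n, x ∈ gammaRegion Ωs k n ↔ n = m)
    (hloc : ∀ x ∈ D ∩ Ω, ∀ i, i ≤ m → (x ∈ maxDomT M₁ Ω i ↔ x ∈ maxDomT M₁ Y i))
    {x : Site P 0} (hx : x ∈ D) (n : ℕ) :
    ((x ∈ gammaRegion Ωs k n ∧ x ∈ innerTwoT M₁ Ω m) ∨
      (x ∈ gammaRegion (maxDomT M₁ Ω) m n ∧ (x ∈ Ω ∧ x ∉ innerTwoT M₁ Ω m))) ↔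
    (x ∈ gammaRegion (maxDomT M₁ Y) m n ∧ x ∈ Y) := by
  have hantiY : Antitone (maxDomT M₁ Y) := fun a b hab => maxDomT_antitone hM Y hab
  by_cases hI : x ∈ innerTwoT M₁ Ω m
  · have hxΩ : x ∈ Ω := innerTwoT_subset Ω m hI
    have hxY : x ∈ Y := hΩY hxΩ
    have hxYm : x ∈ maxDomT M₁ Y m := innerTwoT_subset_maxDomT hM Y m (innerTwoT_mono hΩY m hI)
    have htop : ∀ n, x ∈ gammaRegion (maxDomT M₁ Y) m n ↔ n = m :=
      mem_gammaRegion_iff_eq (maxDomT M₁ Y) hantiY le_rfl hm hxYm (fun h => absurd h (lt_irrefl m))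
    rw [hk x ⟨hx, hI⟩ n, htop n]
    constructor
    · rintro (⟨h, -⟩ | ⟨-, -, hnI⟩)
      · exact ⟨h, hxY⟩
      · exact absurd hI hnI
    · rintro ⟨h, -⟩
      exact Or.inl ⟨h, hI⟩
  · constructor
    · rintro (⟨-, hI'⟩ | ⟨hγ, hxΩ, -⟩)
      · exact absurd hI' hI
      · exact ⟨(mem_gammaRegion_congr _ _ hm (hloc x ⟨hx, hxΩ⟩) n).1 hγ, hΩY hxΩ⟩
    · rintro ⟨hγ, hxY⟩
      have hxΩ : x ∈ Ω := hDY ⟨hx, hxY⟩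
      exact Or.inr ⟨(mem_gammaRegion_congr _ _ hm (hloc x ⟨hx, hxΩ⟩) n).2 hγ, hxΩ, hI⟩

end Generic


/-! ## §5  (1.33): the (2.14)-join `𝔹(Z_{j+1}∖Z_j) ∪ 𝔹_k` at print's instance, and print's simplified form -/

section Eq133Sets

variable {P : Params} (M₁ : ℕ)

/-- **The determining set of (1.33)** p. 184 [PDF 10], *"U(𝔹(Z_{j+1}∖Z_j) ∪ 𝔹_k, ·) … where the determining set was defined in
(2.14) [III]"*, AT PRINT'S INSTANCE.  [III] p. 257: *"We can also have a more complicated situation, in which the boundary ∂Ω is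
contained in several different domains Ω_j∖Ω_{j+1}. Then we construct the corresponding determining sets restricted to the domains,
and we define the set 𝐁∪𝐁(Ω) by (2.14), with the right-hand side summed up over the domains."*  Here `Ω = Z_{j+1}∖Z_j`, whose
boundary lies in the two domains `Ω_{j+1}` (the part `∂Z_{j+1}`, scale `j + 1`) and `Ω_j∖Ω_{j+1}` (the part `∂Z_j`, scale `j`): the
(2.14) join (r11's `joinBj` = r12's `join214` at `𝐁_m(Ω)`, `Ω^{∼−2}` in the scale `m` of the domain) of `𝔹_k = genSet Ωs k`
([III] (2.2) for the density's sequence `{Ω_n}`) with `𝐁_{j+1}(Ω)` restricted to `Ω_{j+1}`, plus the same with `𝐁_j(Ω)` restricted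
to `Ωᶜ_{j+1}`.  `Zj1 = Z_{j+1}`, `Zj = Z_j` (large-field regions, [III] (2.3) `Z_j = Λᶜ_j`), `M₁`-cubes of `T_η` as in
`B14.Eq213DetSet`. [cite: Balaban1989LargeFieldI, (1.33) p.184; Balaban1988Convergent, (2.14) p.257] -/
def join133 (Ωs : ℕ → Set (Site P 0)) (Zj1 Zj : Set (Site P 0)) (j k : ℕ) : DetSet P :=
  (joinBj M₁ (genSet Ωs k) (Zj1 \ Zj) (j + 1)).restrict (Ωs (j + 1)) ∪
    (joinBj M₁ (genSet Ωs k) (Zj1 \ Zj) j).restrict (Ωs (j + 1))ᶜ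

/-- **`𝔹_{j+1}(Z_{j+1})`** of the «in fact» sentence of (1.33): [III] p. 256 *"For this domain we build a minimal determining
set WITH A SUPPORT IN Ω, or a sequence of maximal domains Ω = Ω₀ ⊃ Ω₁ ⊃ … "* — r11's `Bj M₁ Z_{j+1} (j+1)` (= `genSet` of the
torus maximal sequence, whose scale-`0` member is the (2.2)-literal GLOBAL `(Ω₁)ᶜ`, `Bj_zero`) RESTRICTED to its domain
`Z_{j+1}`, i.e. with `Γ₀ = Z_{j+1}∖(Z_{j+1})₁`; at the positive scales the restriction changes nothing (`bUp133_apply_of_pos`).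
[cite: Balaban1989LargeFieldI, (1.33) p.184; Balaban1988Convergent, (2.13) pp.256–257] -/
def bUp133 (Zj1 : Set (Site P 0)) (j : ℕ) : DetSet P := (Bj M₁ Zj1 (j + 1)).restrict Zj1

/-- **`𝔹_j(Zᶜ_j)`** of the «in fact» sentence of (1.33): r11's `Bj M₁ Zᶜ_j j` with a support in its domain `Zᶜ_j = Λ_j`
(cf. `bUp133`). [cite: Balaban1989LargeFieldI, (1.33) p.184; Balaban1988Convergent, (2.13) pp.256–257] -/
def bLow133 (Zj : Set (Site P 0)) (j : ℕ) : DetSet P := (Bj M₁ Zjᶜ j).restrict Zjᶜ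

variable {M₁}

/-- Unfolding of the two-domain join, scale by scale (definitional). [cite: Balaban1989LargeFieldI, (1.33) p.184] -/
theorem join133_apply (Ωs : ℕ → Set (Site P 0)) (Zj1 Zj : Set (Site P 0)) (j k n : ℕ) :
    join133 M₁ Ωs Zj1 Zj j k n =
      (joinBj M₁ (genSet Ωs k) (Zj1 \ Zj) (j + 1) n ∩ pts n (Ωs (j + 1))) ∪
        (joinBj M₁ (genSet Ωs k) (Zj1 \ Zj) j n ∩ pts n (Ωs (j + 1))ᶜ) := rfl

/-- The (2.14) join is SUPPORTED IN ITS DOMAIN `Ω = Z_{j+1}∖Z_j` at every scale, scale `0` included (both pieces of (2.14) are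
cut to `Ω^{∼−2}` resp. `Ω∖Ω^{∼−2}`). [cite: Balaban1988Convergent, (2.14) p.257; Balaban1989LargeFieldI, (1.33) p.184] -/
theorem join133_subset (Ωs : ℕ → Set (Site P 0)) (Zj1 Zj : Set (Site P 0)) (j k n : ℕ) :
    join133 M₁ Ωs Zj1 Zj j k n ⊆ pts n (Zj1 \ Zj) := by
  have key : ∀ m, joinBj M₁ (genSet Ωs k) (Zj1 \ Zj) m n ⊆ pts n (Zj1 \ Zj) := by
    intro m y hy
    rw [joinBj_apply] at hy
    rcases hy with ⟨-, hy⟩ | ⟨-, hy⟩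
    · exact Set.preimage_mono (innerTwoT_subset (Zj1 \ Zj) m) hy
    · exact (Set.preimage_mono Set.sdiff_subset) hy
  rintro y (⟨hy, -⟩ | ⟨hy, -⟩)
  · exact key _ hy
  · exact key _ hy

/-- At the positive scales the support clause of `𝔹_{j+1}(Z_{j+1})` is automatic: `bUp133 = Bj` there (`Bj_subset_pts`).
[cite: Balaban1988Convergent, (2.13) pp.256–257] -/
theorem bUp133_apply_of_pos (hM : 1 ≤ M₁) (Zj1 : Set (Site P 0)) (j : ℕ) {n : ℕ} (hn : 0 < n) :
    bUp133 M₁ Zj1 j n = Bj M₁ Zj1 (j + 1) n := by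
  unfold bUp133
  rw [DetSet.restrict_apply]
  exact Set.inter_eq_left.2 (Bj_subset_pts hM hn)

/-- Likewise `bLow133 = Bj` at the positive scales. [cite: Balaban1988Convergent, (2.13) pp.256–257] -/
theorem bLow133_apply_of_pos (hM : 1 ≤ M₁) (Zj : Set (Site P 0)) (j : ℕ) {n : ℕ} (hn : 0 < n) :
    bLow133 M₁ Zj j n = Bj M₁ Zjᶜ j n := by
  unfold bLow133
  rw [DetSet.restrict_apply]
  exact Set.inter_eq_left.2 (Bj_subset_pts hM hn)

/-- At scale `0` the support clause matters: `(𝔹_{j+1}(Z_{j+1}))₀ = Z_{j+1}∖(Z_{j+1})₁`, whereas the (2.2)-literal `(Bj …)₀ =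
((Z_{j+1})₁)ᶜ` also contains `Zᶜ_{j+1} = Λ_{j+1}`. [cite: Balaban1988Convergent, (2.2) p.255, (2.13) pp.256–257] -/
theorem bUp133_zero (Zj1 : Set (Site P 0)) (j : ℕ) :
    bUp133 M₁ Zj1 j 0 = pts 0 (Zj1 \ maxDomT M₁ Zj1 1) := by
  unfold bUp133
  rw [DetSet.restrict_apply, Bj_zero (Nat.succ_pos j)]
  ext x
  simp only [Set.mem_inter_iff, Set.mem_compl_iff, mem_pts, Set.mem_sdiff]
  exact and_comm

end Eq133Sets

/-! ## §6  The located geometry of p. 184 / [III] (2.1), (3.5), (3.20), and the «in fact» identity PROVED -/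

section InFact

variable {P : Params} {M₁ : ℕ}

/-- **The geometric situation of (1.33)** (p. 184: *"in the above case"* = the setting of §1, conditions (i), (ii) p. 177: the
operations `T^{(j)}` of (1.2) *"have the simplest form"*, no 𝐑-operation inside the component), every clause LOCATED:
* `hM`, `hdiv`: `M₁ ≥ 1` and the cube side `s_{j+1} = L^{j+1}M₁` divides the torus size (all scales are powers of `L` below the
  torus size, [I] (0.1); r11's standing hypothesis of `B14.Eq213DetSet`);
* `hj`, `hjk`: `1 ≤ j`, `j + 1 ≤ k` ((1.2) p. 178: `h ≤ j ≤ k − 1`);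
* `anti`: `Ω₁ ⊃ Ω₂ ⊃ … ⊃ Ω_k` ([III] (2.1));
* `hΩj2`, `hΛj1`, `hΩj1`, `hΛj`: `Ω_{j+2} ⊂ Λ_{j+1} ⊂ Ω_{j+1} ⊂ Λ_j ⊂ Ω_j` ([III] (2.1) *"Ω₁ ⊃ Λ₁ ⊃ Ω₂ ⊃ Λ₂ ⊃ … ⊃ Ω_k ⊃ Λ_k"*,
  with `Z_j = Λᶜ_j` (2.3));
* `far1`: no point of `Z_j = Λᶜ_j` within sup-distance `3·s_{j+1}` (on the cover) of a point of `Ω_{j+1} ∩ Z_{j+1}` ([III] p. 256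
  *"the distance between their boundaries is at least equal to 2MR_j"*, (3.5): `Ω_{j+1}` lies inside `(Z′^{∼4}_j)ᶜ`);
* `far0`: no point of `Λ_{j+1}` within sup-distance `3·s_j` of a point of `Ωᶜ_{j+1} ∩ Λ_j` ([III] (3.20): `Λ_{j+1} ⊂ Ω^{∼−2}_{j+1}`,
  two layers of `LMR_{j+1}`-cubes).
No analytic content; a bundle of located hypotheses (as r12's `B15Eq112Admissible.Hypotheses`).
[cite: Balaban1989LargeFieldI, (1.33) p.184; Balaban1988Convergent, (2.1) p.254, (3.20) p.269] -/
structure Geometry133 (P : Params) (M₁ : ℕ) (Ωs : ℕ → Set (Site P 0)) (Zj1 Zj : Set (Site P 0)) (j k : ℕ) : Prop where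
  hM : 1 ≤ M₁
  hdiv : side P.L M₁ (j + 1) ∣ P.sitesPerDir 0
  hj : 1 ≤ j
  hjk : j + 1 ≤ k
  anti : Antitone Ωs
  hΩj2 : Ωs (j + 2) ⊆ Zj1ᶜ
  hΛj1 : Zj1ᶜ ⊆ Ωs (j + 1)
  hΩj1 : Ωs (j + 1) ⊆ Zjᶜ
  hΛj : Zjᶜ ⊆ Ωs j
  far1 : ∀ a ∈ Ωs (j + 1) ∩ Zj1, ∀ z : Pt P.d, Within (3 * side P.L M₁ (j + 1) : ℤ) (lift P a) z → cover P z ∉ Zj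
  far0 : ∀ a ∈ (Ωs (j + 1))ᶜ ∩ Zjᶜ, ∀ z : Pt P.d, Within (3 * side P.L M₁ j : ℤ) (lift P a) z → cover P z ∈ Zj1

namespace Geometry133

variable {Ωs : ℕ → Set (Site P 0)} {Zj1 Zj : Set (Site P 0)} {j k : ℕ} (H : Geometry133 P M₁ Ωs Zj1 Zj j k)
include H

/-- `Z_j ⊂ Z_{j+1}` (from `Λ_{j+1} ⊂ Ω_{j+1} ⊂ Λ_j`). [cite: Balaban1988Convergent, (2.1) p.254] -/
theorem Zj_subset : Zj ⊆ Zj1 := by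
  intro x hx
  by_contra hx1
  exact H.hΩj1 (H.hΛj1 hx1) hx

/-- The standing divisibility at scale `j`. [folklore] -/
private theorem hdiv_j : side P.L M₁ j ∣ P.sitesPerDir 0 := dvd_trans (side_dvd_side_succ P.L M₁ j) H.hdiv

/-- **Half A (inside `Ω_{j+1}`)**: at a point of `Ω_{j+1}` and every scale `n`, the scale-`(j+1)` piece of the join agrees with
`𝔹_{j+1}(Z_{j+1})` (supported in `Z_{j+1}`) — locality of the maximal sequence away from `Z_j` (`far1`), and `Γ_{j+1}` is the only
member of `𝔹_k` on `Ω_{j+1} ∩ Ω^{∼−2}` (`Ω_{j+2} ∩ Z_{j+1} = ∅`). [cite: Balaban1989LargeFieldI, (1.33) p.184] -/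
theorem halfA {x : Site P 0} (hx : x ∈ Ωs (j + 1)) (n : ℕ) :
    ((x ∈ gammaRegion Ωs k n ∧ x ∈ innerTwoT M₁ (Zj1 \ Zj) (j + 1)) ∨
      (x ∈ gammaRegion (maxDomT M₁ (Zj1 \ Zj)) (j + 1) n ∧ (x ∈ Zj1 \ Zj ∧ x ∉ innerTwoT M₁ (Zj1 \ Zj) (j + 1)))) ↔
    (x ∈ gammaRegion (maxDomT M₁ Zj1) (j + 1) n ∧ x ∈ Zj1) := by
  refine join_half_iff H.hM (by omega) Set.sdiff_subset (fun y hy => ⟨hy.2, fun hZ => H.hΩj1 hy.1 hZ⟩) ?_ ?_ hx n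
  · rintro y ⟨hy, hyI⟩ m
    have hyΩ : y ∈ Zj1 \ Zj := innerTwoT_subset _ _ hyI
    exact mem_gammaRegion_iff_eq Ωs H.anti H.hjk (by omega) hy (fun _ h2 => H.hΩj2 h2 hyΩ.1) m
  · rintro y ⟨hy, hyΩ⟩ i hi
    refine maxDomT_local H.hM H.hdiv (fun z hz => ?_) hi
    exact ⟨fun h => h.1, fun h => ⟨h, H.far1 y ⟨hy, hyΩ.1⟩ z hz⟩⟩

/-- **Half B (outside `Ω_{j+1}`)**: at a point of `Ωᶜ_{j+1}` and every scale `n`, the scale-`j` piece of the join agrees with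
`𝔹_j(Zᶜ_j)` (supported in `Λ_j`) — locality away from `Λ_{j+1}` (`far0`), and `Γ_j` is the only member of `𝔹_k` on
`Ωᶜ_{j+1} ∩ Ω^{∼−2}` (`Λ_j ⊂ Ω_j`). [cite: Balaban1989LargeFieldI, (1.33) p.184] -/
theorem halfB {x : Site P 0} (hx : x ∉ Ωs (j + 1)) (n : ℕ) :
    ((x ∈ gammaRegion Ωs k n ∧ x ∈ innerTwoT M₁ (Zj1 \ Zj) j) ∨
      (x ∈ gammaRegion (maxDomT M₁ (Zj1 \ Zj)) j n ∧ (x ∈ Zj1 \ Zj ∧ x ∉ innerTwoT M₁ (Zj1 \ Zj) j))) ↔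
    (x ∈ gammaRegion (maxDomT M₁ Zjᶜ) j n ∧ x ∈ Zjᶜ) := by
  have hΩY : Zj1 \ Zj ⊆ Zjᶜ := fun y hy => hy.2
  have hDY : (Ωs (j + 1))ᶜ ∩ Zjᶜ ⊆ Zj1 \ Zj := by
    rintro y ⟨hy1, hy2⟩
    refine ⟨?_, hy2⟩
    by_contra hy3
    exact hy1 (H.hΛj1 hy3)
  refine join_half_iff (Y := Zjᶜ) (Ω := Zj1 \ Zj) (D := (Ωs (j + 1))ᶜ) H.hM H.hj hΩY hDY ?_ ?_ hx n
  · rintro y ⟨hy, hyI⟩ m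
    have hyΩ : y ∈ Zj1 \ Zj := innerTwoT_subset (Zj1 \ Zj) j hyI
    exact mem_gammaRegion_iff_eq Ωs H.anti (by have := H.hjk; omega) H.hj (H.hΛj hyΩ.2) (fun _ => hy) m
  · rintro y ⟨hy, hyΩ⟩ i hi
    refine maxDomT_local H.hM H.hdiv_j (fun z hz => ?_) hi
    exact ⟨fun h => h.2, fun h => ⟨H.far0 y ⟨hy, hyΩ.2⟩ z hz, h⟩⟩

/-- **(1.33), the «in fact» sentence, PROVED** (p. 184 [PDF 10], verbatim: *"In fact in the above case it is simply given by
𝔹_{j+1}(Z_{j+1})↾_{Ω_{j+1}} ∪ 𝔹_j(Z^c_j)↾_{Ω^c_{j+1}}"*; [III] p. 269: *"the determining set 𝐁(Λᶜ_{k+1}∩Λ_k)∪𝐁_{k+1} defined in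
(2.14), which in this case is simply equal to the union 𝐁_{k+1}(Λᶜ_{k+1})|_{Ω_{k+1}} ∪ 𝐁_k(Λ_k)|_{Ωᶜ_{k+1}}"*): in the located
geometry the two-domain (2.14) join `𝔹(Z_{j+1}∖Z_j) ∪ 𝔹_k` IS the union of the two standard localized determining sets (each with
a support in its domain), as an identity of determining sets, every scale. [cite: Balaban1989LargeFieldI, (1.33) p.184] -/
theorem join133_eq :
    join133 M₁ Ωs Zj1 Zj j k = (bUp133 M₁ Zj1 j).restrict (Ωs (j + 1)) ∪ (bLow133 M₁ Zj j).restrict (Ωs (j + 1))ᶜ := by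
  funext n
  ext y
  simp only [join133, bUp133, bLow133, joinBj_apply, Bj_apply, genSet, DetSet.union_apply, DetSet.restrict_apply,
    Set.mem_union, Set.mem_inter_iff, mem_pts, Set.mem_sdiff, Set.mem_compl_iff]
  by_cases hx : embIter n y ∈ Ωs (j + 1)
  · have h := H.halfA hx n
    simp only [Set.mem_sdiff] at h
    simp only [hx, not_true_eq_false, and_false, or_false, and_true]
    exact h
  · have h := H.halfB hx n
    simp only [Set.mem_sdiff, Set.mem_compl_iff] at h
    simp only [hx, not_false_eq_true, and_true, and_false, false_or]
    exact h

/-- At the POSITIVE scales the identity holds equally for r11's unrestricted `Bj` (the support clause only acts at scale `0`).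
[cite: Balaban1989LargeFieldI, (1.33) p.184; Balaban1988Convergent, (2.13) pp.256–257] -/
theorem join133_apply_of_pos {n : ℕ} (hn : 0 < n) :
    join133 M₁ Ωs Zj1 Zj j k n =
      ((Bj M₁ Zj1 (j + 1)).restrict (Ωs (j + 1)) ∪ (Bj M₁ Zjᶜ j).restrict (Ωs (j + 1))ᶜ) n := by
  rw [H.join133_eq]
  simp only [DetSet.union_apply, DetSet.restrict_apply, bUp133_apply_of_pos H.hM _ _ hn,
    bLow133_apply_of_pos H.hM _ _ hn]

/-- … whereas at scale `0` the (2.2)-literal members `((Z_{j+1})₁)ᶜ ↾ Ω_{j+1} ⊇ Λ_{j+1}` and `((Λ_j)₁)ᶜ ↾ Ωᶜ_{j+1} ⊇ Z_j` lie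
OUTSIDE `Z_{j+1}∖Z_j`, where the join has nothing (`join133_subset`): with the unrestricted `Bj` the printed identity FAILS as soon
as `Λ_{j+1} ∪ Z_j` is nonempty — which fixes the reading *"with a support in Ω"* of [III] p. 256 for `𝔹_{j+1}(Z_{j+1})`, `𝔹_j(Zᶜ_j)`.
[cite: Balaban1989LargeFieldI, (1.33) p.184; Balaban1988Convergent, (2.2) p.255, (2.13) pp.256–257] -/
theorem join133_ne_unrestricted (hne : ((Zj1ᶜ ∩ Ωs (j + 1)) ∪ (Zj ∩ (Ωs (j + 1))ᶜ)).Nonempty) :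
    join133 M₁ Ωs Zj1 Zj j k ≠
      (Bj M₁ Zj1 (j + 1)).restrict (Ωs (j + 1)) ∪ (Bj M₁ Zjᶜ j).restrict (Ωs (j + 1))ᶜ := by
  obtain ⟨x, hx⟩ := hne
  intro heq
  have h0 := congrFun heq 0
  have hxR : x ∈ ((Bj M₁ Zj1 (j + 1)).restrict (Ωs (j + 1)) ∪ (Bj M₁ Zjᶜ j).restrict (Ωs (j + 1))ᶜ) 0 := by
    simp only [DetSet.union_apply, DetSet.restrict_apply, Bj_zero (Nat.succ_pos j), Bj_zero H.hj, Set.mem_union,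
      Set.mem_inter_iff, Set.mem_compl_iff, mem_pts]
    rcases hx with ⟨hx1, hx2⟩ | ⟨hx1, hx2⟩
    · exact Or.inl ⟨fun h => hx1 (maxDomT_subset H.hM Zj1 1 h), hx2⟩
    · exact Or.inr ⟨fun h => (maxDomT_subset H.hM Zjᶜ 1 h) hx1, hx2⟩
  rw [← h0] at hxR
  have hxΩ := join133_subset Ωs Zj1 Zj j k 0 hxR
  simp only [mem_pts, Set.mem_sdiff] at hxΩ hx
  rcases hx with ⟨hx1, -⟩ | ⟨hx1, -⟩
  · exact hx1 hxΩ.1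
  · exact hxΩ.2 hx1

end Geometry133

end InFact


/-! ## §7  (1.33) WITH THE DISPLAYED BODY, its equality with r12's `vSeam133`, and the sentence on `Q^{s*}V` -/

section Eq133Config

variable {P : Params} {G : Type*} [GaugeGroup G] {av : ∀ j, Averaging P j G} (bg : DetBackground P G av) (M₁ : ℕ)

/-- **(1.33)** p. 184 [PDF 10] WITH THE DISPLAYED BODY, verbatim: *"The configuration V^{(j)}_{Z_{j+1}∖Z_j} is defined on
Z^{∼−1}_{j+1}∖Z^∼_j by V^{(j)}_{Z_{j+1}∖Z_j} = M^j(U(𝔹(Z_{j+1}∖Z_j) ∪ 𝔹_k, M˙(Q^{s*}V))), (1.33) where the determining set was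
defined in (2.14) [III]."* — the `j`-th average (`Setup.Averaging.iter`) of the [III] (2.12) solution map (DATA `DetBackground.U`,
[15] Thm 1 = rows B14.Eq2.12 / B11.Thm1, not asserted) AT the two-domain (2.14) join `join133` and the data `M˙(Q^{s*}V) = avgFamily
av QsV` ([III] (2.11)); `QsV` = the fine configuration `Q^{s*}V` of the last sentence of (1.33) (`IsQsV133`, witness `qsV133`).
r12's `B15DeterminingSets.vSeam133` (p243299) types the same display by print's simplified form; `vSeam133join_eq_vSeam133` is the
printed identification of the two. [cite: Balaban1989LargeFieldI, (1.33) p.184] -/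
noncomputable def vSeam133join (Ωs : ℕ → Set (Site P 0)) (Zj1 Zj : Set (Site P 0)) (j k : ℕ) (QsV : GaugeField P 0 G) :
    GaugeField P j G :=
  Averaging.iter av j (bg.U (join133 M₁ Ωs Zj1 Zj j k) (avgFamily av QsV))

/-- Unfolding of (1.33) (definitional). [cite: Balaban1989LargeFieldI, (1.33) p.184] -/
theorem vSeam133join_def (Ωs : ℕ → Set (Site P 0)) (Zj1 Zj : Set (Site P 0)) (j k : ℕ) (QsV : GaugeField P 0 G) :
    vSeam133join bg M₁ Ωs Zj1 Zj j k QsV = Averaging.iter av j (bg.U (join133 M₁ Ωs Zj1 Zj j k) (avgFamily av QsV)) := rfl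

variable {M₁}

/-- **(1.33) = r12's `vSeam133` at print's instance**: in the located geometry, the displayed configuration
`M^j(U(𝔹(Z_{j+1}∖Z_j) ∪ 𝔹_k, M˙(Q^{s*}V)))` IS `M^j(U(𝔹_{j+1}(Z_{j+1})↾_{Ω_{j+1}} ∪ 𝔹_j(Zᶜ_j)↾_{Ωᶜ_{j+1}}, M˙(Q^{s*}V)))` with the
two localized determining sets supported in their domains (`bUp133`, `bLow133`) — the «in fact» sentence at the level of the
configurations (same solution datum, same determining set by `Geometry133.join133_eq`). [cite: Balaban1989LargeFieldI, (1.33) p.184] -/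
theorem vSeam133join_eq_vSeam133 {Ωs : ℕ → Set (Site P 0)} {Zj1 Zj : Set (Site P 0)} {j k : ℕ}
    (H : Geometry133 P M₁ Ωs Zj1 Zj j k) (QsV : GaugeField P 0 G) :
    vSeam133join bg M₁ Ωs Zj1 Zj j k QsV = vSeam133 bg (bUp133 M₁ Zj1 j) (bLow133 M₁ Zj j) (Ωs (j + 1)) QsV j := by
  unfold vSeam133join vSeam133
  rw [H.join133_eq]

/-- The LAST SENTENCE of (1.33) p. 184, verbatim: *"and the configuration Q^{s*}V is equal to Q^{s*}_{j+1}V_{j+1} on Ω_{j+1}∩Z_{j+1},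
and to Q^{s*}_jV_j on Ω^c_{j+1}∩Z^c_j"* ([III] p. 269: the data *"(M˙(Q^{s*}_{k+1}V_{k+1})|_{Λᶜ_{k+1}∩Ω_{k+1}}, M˙(Q^{s*}_kV_k)|_{Λ_k∩Ωᶜ_{k+1}})"*)
— as a located PROPERTY of the fine configuration `QsV`: on every bond of `T_η` with both endpoints in `Ω_{j+1} ∩ Z_{j+1}` it is
`Q^{s*}_{j+1}V_{j+1}` (p31's `qsstarGIter0 (j+1)`, [III] (1.3) with `(j+1)`-blocks), on every bond with both endpoints in
`Ωᶜ_{j+1} ∩ Zᶜ_j` it is `Q^{s*}_jV_j` (print pins nothing else; interface bonds follow the user's convention). [cite: Balaban1989LargeFieldI, (1.33) p.184] -/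
def IsQsV133 (Ωs : ℕ → Set (Site P 0)) (Zj1 Zj : Set (Site P 0)) (j : ℕ) (V : MSField P G) (QsV : GaugeField P 0 G) : Prop :=
  (∀ b : PBond P 0, b.src ∈ Ωs (j + 1) ∩ Zj1 → b.tgt ∈ Ωs (j + 1) ∩ Zj1 → QsV b = qsstarGIter0 (j + 1) (V (j + 1)) b) ∧
    (∀ b : PBond P 0, b.src ∈ (Ωs (j + 1))ᶜ ∩ Zjᶜ → b.tgt ∈ (Ωs (j + 1))ᶜ ∩ Zjᶜ → QsV b = qsstarGIter0 j (V j) b)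

/-- The instance of `Q^{s*}V` used by r11's (1.8) instance `B15Eq13Concrete.vSeam18` (p386016): `Q^{s*}_{j+1}V_{j+1}` on the bonds
meeting `Ω_{j+1}`, `Q^{s*}_jV_j` on the others (r12's `spliceAt`). [cite: Balaban1989LargeFieldI, (1.33) p.184] -/
noncomputable def qsV133 (Ωs : ℕ → Set (Site P 0)) (V : MSField P G) (j : ℕ) : GaugeField P 0 G :=
  spliceAt (pts 0 (Ωs (j + 1))) (qsstarGIter0 (j + 1) (V (j + 1))) (qsstarGIter0 j (V j))

/-- `qsV133` HAS the printed property of the last sentence of (1.33). [cite: Balaban1989LargeFieldI, (1.33) p.184] -/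
theorem isQsV133_qsV133 (Ωs : ℕ → Set (Site P 0)) (Zj1 Zj : Set (Site P 0)) (j : ℕ) (V : MSField P G) :
    IsQsV133 Ωs Zj1 Zj j V (qsV133 Ωs V j) := by
  constructor
  · intro b hs _
    simp only [qsV133, spliceAt]
    split_ifs with h
    · rfl
    · exact absurd (Or.inl hs.1) h
  · intro b hs ht
    simp only [qsV133, spliceAt]
    split_ifs with h
    · rcases h with h | h
      · exact absurd h hs.1
      · exact absurd h ht.1
    · rfl

/-- Hence, in the located geometry and for the printed data, (1.33) at print's full instance reads
`V^{(j)}_{Z_{j+1}∖Z_j} = M^j(U(𝔹_{j+1}(Z_{j+1})↾_{Ω_{j+1}} ∪ 𝔹_j(Zᶜ_j)↾_{Ωᶜ_{j+1}}, M˙(Q^{s*}V)))` with `Q^{s*}V = qsV133`.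
[cite: Balaban1989LargeFieldI, (1.33) p.184] -/
theorem vSeam133join_qsV133 {Ωs : ℕ → Set (Site P 0)} {Zj1 Zj : Set (Site P 0)} {j k : ℕ}
    (H : Geometry133 P M₁ Ωs Zj1 Zj j k) (V : MSField P G) :
    vSeam133join bg M₁ Ωs Zj1 Zj j k (qsV133 Ωs V j) =
      vSeam133 bg (bUp133 M₁ Zj1 j) (bLow133 M₁ Zj j) (Ωs (j + 1)) (qsV133 Ωs V j) j :=
  vSeam133join_eq_vSeam133 bg H _

end Eq133Config


/-! ## §8  The two separations of `Geometry133` from [III] (3.5) and (3.20) in their typed cover forms -/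

section Separations

variable {P : Params} {M₁ : ℕ}

/-- **`far1` from [III] (3.5).**  (3.5) p. 265 gives `Ω_{j+1} ⊆ (Z̃⁸_j)ᶜ` — eight layers of `LMR_{j+1}`-cubes (side `s′`
on the cover) between `Ω_{j+1}` and `Z_j` (`B14DomainGeom.omega35_subset_compl_enl`, here its conclusion on the pull-backs);
hence no point of `Z_j` lies within sup-distance `3·s_{j+1}` of a point of `Ω_{j+1}` as soon as `3·s_{j+1} ≤ 8·s′`
(print: `3L^{j+1}M₁ ≤ 8L^{j+1}MR_{j+1}`). [cite: Balaban1988Convergent, (3.5) p.265] -/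
theorem far1_of_eq35 {Ωj1 Zj : Set (Site P 0)} {s' : ℕ} (hs' : 0 < s')
    (h35 : cover P ⁻¹' Ωj1 ⊆ (enl s' 8 (cover P ⁻¹' Zj))ᶜ) {j : ℕ} (hnum : 3 * side P.L M₁ (j + 1) ≤ 8 * s')
    {a : Site P 0} (ha : a ∈ Ωj1) (z : Pt P.d) (hz : Within (3 * side P.L M₁ (j + 1) : ℤ) (lift P a) z) :
    cover P z ∉ Zj := by
  intro hzZ
  have ha' : lift P a ∈ cover P ⁻¹' Ωj1 := by
    rw [Set.mem_preimage, cover_lift]; exact ha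
  have h8 : Within (((8 : ℕ) : ℤ) * s') (lift P a) z :=
    Within.mono (by exact_mod_cast hnum) hz
  exact h35 ha' ⟨z, hzZ, idxNear_of_within s' 8 hs' h8⟩

/-- **`far0` from [III] (3.20).**  (3.20) p. 269, `Λ_{j+1} = ((Ωᶜ_{j+1})^{∼2} ∪ R′^∼_{j+1})ᶜ` (side `s′` = the
`LMR_{j+1}`-cubes on the cover; `B14DomainGeom.lambda320_far_from_compl`): no point of `Λ_{j+1}` lies within sup-distance
`3·s_j` of a point outside `Ω_{j+1}` as soon as `3·s_j ≤ 2·s′` (print: `3L^jM₁ ≤ 2L^{j+1}MR_{j+1}`).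
[cite: Balaban1988Convergent, (3.20) p.269] -/
theorem far0_of_eq320 {Ωj1 Λj1 : Set (Site P 0)} {s' : ℕ} (hs' : 0 < s') {R1 : Set (Pt P.d)}
    (h320 : cover P ⁻¹' Λj1 = (enl s' 2 (cover P ⁻¹' Ωj1)ᶜ ∪ R1)ᶜ) {j : ℕ} (hnum : 3 * side P.L M₁ j ≤ 2 * s')
    {a : Site P 0} (ha : a ∉ Ωj1) (z : Pt P.d) (hz : Within (3 * side P.L M₁ j : ℤ) (lift P a) z) :
    cover P z ∈ Λj1ᶜ := by
  intro hzΛ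
  have hzΛ' : z ∈ cover P ⁻¹' Λj1 := hzΛ
  have ha' : lift P a ∉ cover P ⁻¹' Ωj1 := by
    rw [Set.mem_preimage, cover_lift]; exact ha
  have h2 : Within (2 * (s' : ℤ)) z (lift P a) :=
    Within.mono (by exact_mod_cast hnum) hz.symm
  exact lambda320_far_from_compl s' hs' h320 hzΛ' ha' h2

end Separations

end Literature.MathematicalPhysics.QuantumFieldTheory.Balaban1983to89.B15Eq133JoinDeterminingSet
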